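import Mathlib
import HarnessLib

/-!
# The Bulirsch–Stoer variant of Romberg integration (Davis–Rabinowitz 1984, Sect. 6.3.1, (6.3.1.1))

**Source.** P. J. Davis, P. Rabinowitz, *Methods of Numerical Integration* (2nd ed., Academic Press, 1984),
Sect. 6.3.1 "Further Variants of Romberg".

**Statement.** Bulirsch and Stoer compute trapezoidal sums `T(h_j)`, `h_j = (b − a)/n_j`, for a sequence of integers
`n_0, n_1, …` with `n_i/n_{i+1} ≤ β < 1` — "the sequence `{1, 2, 3, 4, 6, 8, 12, …}` is particularly recommended" — fit a
rational function of `h²`, `T̂_k^i(h) = (c_0 + ⋯ + c_μ h^{2μ})/(d_0 + ⋯ + d_ν h^{2ν})`, `μ = [k/2]`, `ν = k − μ`, through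
`T(h_i), …, T(h_{i+k})`, and extrapolate `T_k^i = T̂_k^i(0)`; the triangle is generated by (6.3.1.1), or by the compact
Stoer–Bulirsch recursion
`T_k^j = T_{k−1}^{j+1} + (T_{k−1}^{j+1} − T_{k−1}^j) / ( (h_j/h_{j+k})² [1 − (T_{k−1}^{j+1} − T_{k−1}^j)/(T_{k−1}^{j+1} − T_{k−2}^{j+1})] − 1 )`
(with `T_{−1} = 0`; Stoer–Bulirsch [1, p. 135] — the leading term is the FINER value `T_{k−1}^{j+1}`: with the coarser
`T_{k−1}^{j}` in its place the `k = 1` case already disagrees with rational extrapolation, see `bulirschStep_ne_coarse_variant`).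

**What is typed** (all PROVED, Mathlib only):
* the Bulirsch sequence `bulirschSeq = 1, 2, 3, 4, 6, 8, 12, 16, 24, …` (`n_{i+2} = 2 n_i` from `i = 1` on): its first
  values, the closed forms `n_{2k+1} = 2^{k+1}`, `n_{2k+2} = 3·2^k`, positivity, strict growth, and the ratio condition with
  the sharp constant `β = 3/4` (`bulirschSeq_ratio_le : n_i/n_{i+1} ≤ 3/4`, attained at `i = 2`);
* the first extrapolation step `k = 1` (`μ = 0`, `ν = 1`: `T̂(h) = c_0/(d_0 + d_1 h²)`, i.e. `1/T̂` linear in `h²`):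
  `bulirschStep T T' h h' = (h² − h'²) T T' / (h² T − h'² T')` is the value at `0` of the interpolant through
  `(h, T), (h', T')` (`bulirschStep_interpolates`), and it coincides with the compact recursion at `k = 1`
  (`bulirschStep_eq_compact`); for comparison, the polynomial (Romberg/Richardson) step in `h²` is
  `(h² T' − h'² T)/(h² − h'²)` and the two agree to first order: their difference is
  `h² h'² (T − T')² / ((h² − h'²)(h² T − h'² T'))` (`bulirschStep_sub_rombergPolyStep`).

References: [cite: DavisRabinowitz1984, Sect. 6.3.1 (6.3.1.1)].
-/

namespace Literature.Analysis.Quadrature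

/-! ## The Bulirsch sequence `1, 2, 3, 4, 6, 8, 12, …` -/

/-- The Bulirsch sequence of panel numbers `n_0, n_1, … = 1, 2, 3, 4, 6, 8, 12, 16, 24, …` (`n_{i+2} = 2 n_i`, `i ≥ 1`).
[cite: DavisRabinowitz1984, Sect. 6.3.1] -/
def bulirschSeq : ℕ → ℕ
  | 0 => 1
  | 1 => 2
  | 2 => 3
  | n + 3 => 2 * bulirschSeq (n + 1)

/-- The first nine terms: `1, 2, 3, 4, 6, 8, 12, 16, 24`. [cite: DavisRabinowitz1984, Sect. 6.3.1] -/
theorem bulirschSeq_values :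
    (List.range 9).map bulirschSeq = [1, 2, 3, 4, 6, 8, 12, 16, 24] := by
  simp [List.range, List.range.loop, bulirschSeq]

/-- The doubling law `n_{i+2} = 2 n_i` for `i ≥ 1`. [cite: DavisRabinowitz1984, Sect. 6.3.1] -/
theorem bulirschSeq_add_two {i : ℕ} (hi : 1 ≤ i) : bulirschSeq (i + 2) = 2 * bulirschSeq i := by
  obtain ⟨j, rfl⟩ := Nat.exists_eq_add_of_le hi
  rw [show 1 + j + 2 = j + 3 by ring, show 1 + j = j + 1 by ring, bulirschSeq]

/-- Closed form of the odd-indexed terms: `n_{2k+1} = 2^{k+1}`. [cite: DavisRabinowitz1984, Sect. 6.3.1] -/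
theorem bulirschSeq_odd (k : ℕ) : bulirschSeq (2 * k + 1) = 2 ^ (k + 1) := by
  induction k with
  | zero => simp [bulirschSeq]
  | succ k ih =>
    rw [show 2 * (k + 1) + 1 = (2 * k + 1) + 2 by ring, bulirschSeq_add_two (by omega), ih, pow_succ]
    ring

/-- Closed form of the even-indexed terms beyond `n_0`: `n_{2k+2} = 3·2^k`. [cite: DavisRabinowitz1984, Sect. 6.3.1] -/
theorem bulirschSeq_even (k : ℕ) : bulirschSeq (2 * k + 2) = 3 * 2 ^ k := by
  induction k with
  | zero => simp [bulirschSeq]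
  | succ k ih =>
    rw [show 2 * (k + 1) + 2 = (2 * k + 2) + 2 by ring, bulirschSeq_add_two (by omega), ih, pow_succ]
    ring

/-- All terms are positive. [cite: DavisRabinowitz1984, Sect. 6.3.1] -/
theorem bulirschSeq_pos (i : ℕ) : 0 < bulirschSeq i := by
  rcases Nat.even_or_odd i with ⟨k, rfl⟩ | ⟨k, rfl⟩
  · rcases k with _ | k
    · simp [bulirschSeq]
    · rw [show k + 1 + (k + 1) = 2 * k + 2 by ring, bulirschSeq_even]; positivity
  · rw [bulirschSeq_odd]; positivity

/-- The sequence is strictly increasing: `n_i < n_{i+1}`. [cite: DavisRabinowitz1984, Sect. 6.3.1] -/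
theorem bulirschSeq_lt_succ (i : ℕ) : bulirschSeq i < bulirschSeq (i + 1) := by
  rcases Nat.even_or_odd i with ⟨k, rfl⟩ | ⟨k, rfl⟩
  · rcases k with _ | k
    · simp [bulirschSeq]
    · rw [show k + 1 + (k + 1) = 2 * k + 2 by ring, show 2 * k + 2 + 1 = 2 * (k + 1) + 1 by ring,
        bulirschSeq_even, bulirschSeq_odd, pow_succ, pow_succ]
      have := Nat.one_le_two_pow (n := k)
      omega
  · rw [bulirschSeq_odd, show 2 * k + 1 + 1 = 2 * k + 2 by ring, bulirschSeq_even, pow_succ]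
    have := Nat.one_le_two_pow (n := k)
    omega

/-- `bulirschSeq` is strictly monotone. [cite: DavisRabinowitz1984, Sect. 6.3.1] -/
theorem bulirschSeq_strictMono : StrictMono bulirschSeq := strictMono_nat_of_lt_succ bulirschSeq_lt_succ

/-- The ratio condition `n_i/n_{i+1} ≤ β < 1` holds with `β = 3/4`: `4 n_i ≤ 3 n_{i+1}`.
[cite: DavisRabinowitz1984, Sect. 6.3.1] -/
theorem bulirschSeq_ratio (i : ℕ) : 4 * bulirschSeq i ≤ 3 * bulirschSeq (i + 1) := by
  rcases Nat.even_or_odd i with ⟨k, rfl⟩ | ⟨k, rfl⟩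
  · rcases k with _ | k
    · simp [bulirschSeq]
    · rw [show k + 1 + (k + 1) = 2 * k + 2 by ring, show 2 * k + 2 + 1 = 2 * (k + 1) + 1 by ring,
        bulirschSeq_even, bulirschSeq_odd, pow_succ]
      omega
  · rw [bulirschSeq_odd, show 2 * k + 1 + 1 = 2 * k + 2 by ring, bulirschSeq_even, pow_succ]
    omega

/-- … in real form: `n_i / n_{i+1} ≤ 3/4`. [cite: DavisRabinowitz1984, Sect. 6.3.1] -/
theorem bulirschSeq_ratio_le (i : ℕ) : (bulirschSeq i : ℝ) / bulirschSeq (i + 1) ≤ 3 / 4 := by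
  have h : ((4 * bulirschSeq i : ℕ) : ℝ) ≤ ((3 * bulirschSeq (i + 1) : ℕ) : ℝ) := by
    exact_mod_cast bulirschSeq_ratio i
  push_cast at h
  have hpos : (0 : ℝ) < bulirschSeq (i + 1) := by exact_mod_cast bulirschSeq_pos (i + 1)
  rw [div_le_iff₀ hpos]
  linarith

/-- The constant `3/4` is sharp: `n_2/n_3 = 3/4`. [cite: DavisRabinowitz1984, Sect. 6.3.1] -/
theorem bulirschSeq_ratio_two : (bulirschSeq 2 : ℝ) / bulirschSeq 3 = 3 / 4 := by
  simp [bulirschSeq]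

/-! ## The first rational extrapolation step (`k = 1`) -/

/-- The `k = 1` Bulirsch–Stoer extrapolate: the value at `h = 0` of `c_0/(d_0 + d_1 h²)` through `(h, T)` and `(h', T')`,
`= (h² − h'²) T T' / (h² T − h'² T')`. [cite: DavisRabinowitz1984, Sect. 6.3.1 (6.3.1.1)] -/
noncomputable def bulirschStep (T T' h h' : ℝ) : ℝ := (h ^ 2 - h' ^ 2) * T * T' / (h ^ 2 * T - h' ^ 2 * T')

/-- **Interpolation property.** With `α = 1/S`, `S = bulirschStep T T' h h'`, and
`β = (1/T − 1/T')/(h² − h'²)`, the function `h ↦ 1/(α + β h²)` (a rational function `c_0/(d_0 + d_1 h²)`) takes the values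
`T` at `h`, `T'` at `h'`, and `S` at `0`. [cite: DavisRabinowitz1984, Sect. 6.3.1 (6.3.1.1)] -/
theorem bulirschStep_interpolates {T T' h h' : ℝ} (hT : T ≠ 0) (hT' : T' ≠ 0) (hh : h ^ 2 ≠ h' ^ 2) :
    let α := 1 / bulirschStep T T' h h'
    let β := (1 / T - 1 / T') / (h ^ 2 - h' ^ 2)
    1 / (α + β * h ^ 2) = T ∧ 1 / (α + β * h' ^ 2) = T' ∧ 1 / (α + β * 0 ^ 2) = bulirschStep T T' h h' := by
  have hsub : h ^ 2 - h' ^ 2 ≠ 0 := sub_ne_zero.2 hh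
  have e1 : 1 / bulirschStep T T' h h' + (1 / T - 1 / T') / (h ^ 2 - h' ^ 2) * h ^ 2 = 1 / T := by
    unfold bulirschStep
    field_simp
    ring
  have e2 : 1 / bulirschStep T T' h h' + (1 / T - 1 / T') / (h ^ 2 - h' ^ 2) * h' ^ 2 = 1 / T' := by
    unfold bulirschStep
    field_simp
    ring
  refine ⟨?_, ?_, ?_⟩
  · rw [e1, one_div_one_div]
  · rw [e2, one_div_one_div]
  · simp

/-- **The compact Stoer–Bulirsch recursion at `k = 1`** (`T_{−1} = 0`; `T = T_0^j` the coarser, `T' = T_0^{j+1}` the finer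
trapezoidal value, steps `h = h_j`, `h' = h_{j+1}`):
`T_1^j = T' + (T' − T)/((h/h')² (1 − (T' − T)/(T' − 0)) − 1)` equals `bulirschStep T T' h h'`.
[cite: DavisRabinowitz1984, Sect. 6.3.1 (6.3.1.1)] -/
theorem bulirschStep_eq_compact {T T' h h' : ℝ} (hT' : T' ≠ 0) (hh' : h' ≠ 0) (hden : h ^ 2 * T - h' ^ 2 * T' ≠ 0) :
    T' + (T' - T) / ((h / h') ^ 2 * (1 - (T' - T) / (T' - 0)) - 1) = bulirschStep T T' h h' := by
  unfold bulirschStep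
  have hden' : (h / h') ^ 2 * (1 - (T' - T) / (T' - 0)) - 1 = (h ^ 2 * T - h' ^ 2 * T') / (h' ^ 2 * T') := by
    field_simp
    ring
  rw [hden', div_div_eq_mul_div, eq_div_iff hden, add_mul, div_mul_cancel₀ _ hden]
  ring

/-- Reading the leading term of the compact recursion as the COARSER value `T` is wrong already at `k = 1`: with
`T = 2`, `T' = 1`, `h = 2`, `h' = 1` that variant gives `13/7`, while rational extrapolation gives `6/7`.
[cite: DavisRabinowitz1984, Sect. 6.3.1 (6.3.1.1)] -/
theorem bulirschStep_ne_coarse_variant :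
    bulirschStep 2 1 2 1 = 6 / 7 ∧
      (2 : ℝ) + (1 - 2) / ((2 / 1) ^ 2 * (1 - (1 - 2) / (1 - 0)) - 1) = 13 / 7 := by
  unfold bulirschStep
  norm_num

/-- The polynomial (Romberg–Richardson) extrapolate in `h²` through the same two points: `(h² T' − h'² T)/(h² − h'²)`.
[cite: DavisRabinowitz1984, Sect. 6.3.1] -/
noncomputable def rombergPolyStep (T T' h h' : ℝ) : ℝ := (h ^ 2 * T' - h' ^ 2 * T) / (h ^ 2 - h' ^ 2)

/-- With `h' = h/2` the polynomial step is the classical Romberg combination `(4T' − T)/3`.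
[cite: DavisRabinowitz1984, Sect. 6.3.1] -/
theorem rombergPolyStep_half {T T' h : ℝ} (hh : h ≠ 0) : rombergPolyStep T T' h (h / 2) = (4 * T' - T) / 3 := by
  unfold rombergPolyStep
  field_simp
  ring

/-- Rational versus polynomial extrapolation: `bulirschStep − rombergPolyStep = h² h'² (T − T')² / ((h² − h'²)(h² T − h'² T'))`
— second order in `T − T'`. [cite: DavisRabinowitz1984, Sect. 6.3.1 (6.3.1.1)] -/
theorem bulirschStep_sub_rombergPolyStep {T T' h h' : ℝ} (hh : h ^ 2 ≠ h' ^ 2) (hden : h ^ 2 * T - h' ^ 2 * T' ≠ 0) :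
    bulirschStep T T' h h' - rombergPolyStep T T' h h' =
      h ^ 2 * h' ^ 2 * (T - T') ^ 2 / ((h ^ 2 - h' ^ 2) * (h ^ 2 * T - h' ^ 2 * T')) := by
  unfold bulirschStep rombergPolyStep
  have hsub : h ^ 2 - h' ^ 2 ≠ 0 := sub_ne_zero.2 hh
  field_simp
  ring

/-- If the two trapezoidal values already agree (`T = T'`), both extrapolates return that value.
[cite: DavisRabinowitz1984, Sect. 6.3.1] -/
theorem bulirschStep_self {T h h' : ℝ} (hT : T ≠ 0) (hh : h ^ 2 ≠ h' ^ 2) :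
    bulirschStep T T h h' = T ∧ rombergPolyStep T T h h' = T := by
  have hsub : h ^ 2 - h' ^ 2 ≠ 0 := sub_ne_zero.2 hh
  unfold bulirschStep rombergPolyStep
  constructor
  · rw [show h ^ 2 * T - h' ^ 2 * T = (h ^ 2 - h' ^ 2) * T by ring]
    field_simp
  · rw [show h ^ 2 * T - h' ^ 2 * T = (h ^ 2 - h' ^ 2) * T by ring]
    field_simp

end Literature.Analysis.Quadrature
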